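import Mathlib
import HarnessLib
import Summits.Langlands.Statement
import Summits.Langlands.Langlands.Theses.PrimeSwitchSplit
import Summits.Langlands.Langlands.Theorems.LiftDescendLArithmeticOfAutToGal
import Literature.NumberTheory.GaloisRepresentations.HeckeCharacterValueFieldProofs
import Literature.NumberTheory.GaloisRepresentations.DeRhamLAdicCharacterHecke

/-!
# `FrobeniusAlgebraicityCarving` — lens-6 (barrier-complement carving), decomp-langlands g32 — CENSUS TWIN (pre-birth Theorems file) of the ROOT-depth node

This file is the node `HOME/nodes/lens-6-g32-FrobeniusAlgebraicityCarving.lean` with its namespace moved from `…Theses.FrobeniusAlgebraicityCarving` to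
`…Theorems.FrobeniusAlgebraicityCarving`, the `#print axioms` guards removed (they live in the node file) and the registry-owned name `closes` renamed
`closes_host`.  No `sorry`.  Supports stmt-Langlands-17414 (context for the queued child route FrobeniusAlgebraicityCarving; the route decls will be
verbatim copies of `FrobeniusAlgebraicity` / `ArithmeticWeakAutomorphy` below, so `Iff.rfl` bridges them after birth).

TARGET (by name): `Summit.Langlands.Langlands.Theses.PrimeSwitchSplit.WeakGeometricAutomorphy` (B_w, stmt-Langlands-17414, ROOT-depth crux of
the served route PrimeSwitchSplit: «every IRREDUCIBLE GEOMETRIC ρ : Γ_K → GL_n(ℚ̄_ℓ) — a.e. unramified, de Rham above ℓ for the pinned Fontaine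
data — is WEAKLY AUTOMORPHIC through ι : ℚ̄_ℓ ≃ ℂ: some L-algebraic cuspidal π has Satake parameters matching ρ(Frob_v) at a.e. v»).

MECHANISM (dial never used on B_w; the g26 census V1–V34 dialled ENGINE-side hypotheses, g30/g31 the archimedean SIZE of Frobenius roots;
this node dials their ARITHMETIC NATURE).  Dial `HasAlgebraicFrobenius K ℓ ρ` := «for almost every place v, every root of every Frobenius
characteristic polynomial of ρ at v is an algebraic number (∈ ℚ̄ ⊂ ℚ̄_ℓ)» — Galois-only, ι-FREE, level-free.  Pieces:

* `FrobeniusAlgebraicity`        (FA, crux r2, DECIDING, NEW · GALOIS-ONLY):  every irreducible geometric ρ has algebraic Frobenius roots a.e.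
                                  = the algebraicity clause of Deligne's «third property» that Fontaine–Mazur predicts for geometric ρ
                                  (Taylor, Galois representations, arXiv:math/0212403 p.5: Conj. 1 (FM) + Conj. 3(i) «R de Rham a.e. unramified
                                  ⇒ part of a weakly compatible system», whose WD_p are defined over ℚ̄).  Leaf: IDEA-NEEDED in the bulk;
                                  PRINT/PROVED sectors = the rungs below + every potentially automorphic ρ (BLGGT 2014 §5; FA descends along
                                  finite L/K EXACTLY since Frob_w = Frob_v^f and is twist/⊕/⊗-stable).
* `ArithmeticWeakAutomorphy`     (AWA, residual r3, WEAKER, S-implied):  B_w VERBATIM on the ρ with algebraic Frobenius roots (ONE inserted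
                                  hypothesis).  Every automorphy engine and every catalogued lifting barrier lives here; not attacked.
* `TranscendentalWeakAutomorphy` (TWA, node-only complement):  B_w on the ρ with transcendental Frobenius roots at infinitely many places —
                                  CERTIFIED S-VOID (`twa_of_fa`).

KERNEL CERTIFICATES (part 2 `FrobeniusAlgebraicityCarvingKernel`; node `lean check` rc 0, 0 sorry; axioms propext / Classical.choice / Quot.sound, guards in the node file):
  `weakAut_iff_cells : B_w ↔ AWA ∧ TWA` (cells) · `closes_host : FA → AWA → B_w` (one-line seam under the B_w binders; `closes` in the node) · `closes_root : FA → AWA →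
  W⁺ → P → A → R → Langlands` (through `PrimeSwitchSplit.closes` + `AvatarConjugacy_holds`) · NECESSITY, EXACT IN KERNEL (no print seam):
  `fa_of_dirA_of_weakAut : (A) → B_w → FA` and `fa_of_langlands : Langlands → FA` — from the LANDED theorem
  `Theorems.lArithmeticOfAutToGal_proof` (LAR(A→G), stmt-1066, p819419: the Frobenius polynomial of an automorphic ρ_{π,ι} is ι⁻¹ of the
  arithmetic Satake polynomial, whose roots are algebraic) applied to the π that B_w supplies and the ρ′ := ρ_{π,ι} that (A) supplies, Frobenius
  root sets being equal a.e. by `SatakeFrobCompatibleAt`; hence `cells_of_langlands : Langlands → FA ∧ AWA` and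
  `cells_iff_target_modA : (A) → (B_w ↔ FA ∧ AWA)` — BOTH pieces are implied by the Statement, neither is EXCESS.
RUNGS (BC5, PROVED here): `finiteOrderAlgebraicityRung` (finite-order ρ: roots of unity — the ARTIN regime, where the S-case `ArtinCase` =
  strong Artin is OPEN ⇒ a separating witness), `projFiniteAlgebraicityRung` (ρ^k = algebraic scalar pointwise: spectrum algebra),
  `rankOneAlgebraicityRung_of_fact` (n = 1 modulo the ONE named tree fact `FramedGaloisRep.exists_heckeCharacter_of_isDeRhamFramed`: a de Rham
  ℓ-adic character is the avatar of an algebraic Hecke character, whose values are algebraic — Serre 1968 / Weil 1956, tree-PROVED value field).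
WHY EACH PIECE IS STRICTLY WEAKER (probes of record in the kit: probesA/B/C rc 0, bc7 CLEAN): FA is Galois-only and says nothing about π
  (FA ↛ B_w, FA ↛ Langlands, FA ↛ AWA); AWA omits exactly the transcendental class (AWA ↛ B_w, ↛ FA); jointly they give B_w (`closes_host`) and are
  given by Langlands (`cells_of_langlands`).  WHY EASIER THAN B_w: FA needs no automorphic object, no ι, no level structure, is inherited from ANY
  finite base change and from potential automorphy, and is decided sector-by-sector by pure algebra (three rungs here); its open bulk is the
  weakest Galois-side shadow of Fontaine–Mazur («Frobenius eigenvalues of geometric ρ are algebraic numbers»), strictly below purity / HT-symmetry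
  (g27 EXCESS) and below the Jacquet–Shalika window GWW (g30) in logical strength claimed from S: FA is S-implied IN KERNEL.
-/

set_option linter.dupNamespace false -- project-wide option (lakefile weak.linter.dupNamespace); `Summit.Langlands.Langlands` is the mandated namespace

namespace Summit.Langlands.Langlands.Theorems.FrobeniusAlgebraicityCarving

open Filter Polynomial
open scoped NumberField

/-! ## Route texts (one-line Props over accepted declarations; the `B_w` binder prefix VERBATIM, ONE anchored edit each) -/

/-- crux (rank 2, DECIDING, NEW, GALOIS-ONLY and ι-FREE): **FROBENIUS ALGEBRAICITY** — for every number field `K`, every `n ≥ 1`, every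
prime `ℓ` and every IRREDUCIBLE GEOMETRIC `ρ : Γ_K → GL_n(ℚ̄_ℓ)` (a.e. unramified, de Rham above `ℓ` for the pinned Fontaine data — the `B_w` prefix
verbatim minus the level `hcpt` and the avatar `ι`), for almost every place `v` every root of every Frobenius characteristic polynomial of `ρ` at `v`
is ALGEBRAIC over `ℚ`.  S-implied in kernel (`fa_of_langlands`); with `ArithmeticWeakAutomorphy` it gives `B_w` (`closes_host`).
WHY IT MIGHT FAIL: it is the Galois-only algebraicity consequence of Fontaine–Mazur, open off the potentially-automorphic / abelian / projectively-finite
sectors: ONE irreducible de Rham ρ (even, irregular weight, n ≥ 2) with a transcendental Frobenius root at infinitely many places refutes it.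
SOURCES: Taylor arXiv:math/0212403 p.5 (Conj. 1 Fontaine–Mazur; Conj. 3(i); «in particular α is algebraic»), p.6 L1–3 (n = 1 by class field
theory, Serre 1968); FontaineMazur1995; Calegari arXiv:2109.14145 §1.1; Kahn 2020 Conj. 5.45/5.49 (Serre C5/C6, Weil numbers of motives);
BarnetLambGeeGeraghtyTaylor2014 §5 (potential automorphy ⇒ compatible systems); tree `Theorems.lArithmeticOfAutToGal_proof` (p819419). [conjecture] -/
def FrobeniusAlgebraicity : Prop :=
  ∀ (K : Type) [Field K] [NumberField K] (n : ℕ), 0 < n → ∀ (ℓ : ℕ) [Fact ℓ.Prime] (ρ : Literature.NumberTheory.GaloisRepresentations.FramedGaloisRep K (PadicAlgCl ℓ) n), ρ.toGaloisRep.IsIrreducible → ((∀ᶠ v : IsDedekindDomain.HeightOneSpectrum (NumberField.RingOfIntegers K) in cofinite, ρ.IsUnramifiedAt v) ∧ ∀ (v : IsDedekindDomain.HeightOneSpectrum (NumberField.RingOfIntegers K)) (hv : ((ℓ : ℕ) : NumberField.RingOfIntegers K) ∈ v.asIdeal), (Literature.NumberTheory.PAdicHodge.fontainePstAdicCompletion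 v ℓ hv).IsDeRhamFramed (ρ.toLocal v)) → ∀ᶠ v : IsDedekindDomain.HeightOneSpectrum (NumberField.RingOfIntegers K) in Filter.cofinite, ∀ P : Polynomial (PadicAlgCl ℓ), ρ.HasFrobCharpolyAt v P → ∀ β ∈ P.roots, IsAlgebraic ℚ β

/-- residual (rank 3, WEAKER, S-implied `awa_of_target`, DECLARED RESIDUAL — every automorphy engine lives here): **ARITHMETIC WEAK
AUTOMORPHY** — `B_w` VERBATIM on the ρ whose Frobenius roots are algebraic numbers at almost every place (ONE inserted hypothesis after the
geometricity clause).  S-implied (`awa_of_target`, a re-binder); every automorphy-lifting / potential-automorphy engine (BLGGT, 10-author, ACC⁺,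
Khare–Wintenberger–Kisin, Langlands–Tunnell, Pilloni–Stroh) and every catalogued barrier of `Literature/Barriers/Langlands` (NonRegularWeight,
ResiduallyReducible, ShimuraVarietyRealization, TwistedEndoscopySelfDual, PatchingLocalComponent, TaylorWilesNumericalCoincidence,
FamilyWitnessConsecutiveWeights, SolvableImage) quantifies over data living in THIS cell.  WHY IT MIGHT FAIL: it is Fontaine–Mazur–Langlands for
GL_n over every number field minus a cell that FA predicts empty — open for even / irregular / non-CM-base ρ.  SOURCES: Calegari arXiv:2109.14145;
ACC⁺ arXiv:1812.09999 Thm 6.1.1; BLGGT 2014 Thm 4.5.1; tree `PrimeSwitchSplit.WeakGeometricAutomorphy` (stmt-17414). [conjecture] -/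
def ArithmeticWeakAutomorphy : Prop :=
  ∀ (K : Type) [Field K] [NumberField K] (n : ℕ) (hcpt : Literature.NumberTheory.Automorphic.isCompact_glFiniteIntegralLevel n K), 0 < n → ∀ (ℓ : ℕ) [Fact ℓ.Prime] (ι : PadicAlgCl ℓ ≃+* ℂ) (ρ : Literature.NumberTheory.GaloisRepresentations.FramedGaloisRep K (PadicAlgCl ℓ) n), ρ.toGaloisRep.IsIrreducible → ((∀ᶠ v : IsDedekindDomain.HeightOneSpectrum (NumberField.RingOfIntegers K) in cofinite, ρ.IsUnramifiedAt v) ∧ ∀ (v : IsDedekindDomain.HeightOneSpectrum (NumberField.RingOfIntegers K)) (hv : ((ℓ : ℕ) : NumberField.RingOfIntegers K) ∈ v.asIdeal), (Literature.NumberTheory.PAdicHodge.fontainePstAdicCompletion v ℓ hv).IsDeRhamFramed (ρ.toLocal v)) → (∀ᶠ v : IsDedekindDomain.HeightOneSpectrum (NumberField.RingOfIntegers K) in Filter.cofinite, ∀ P : Polynomial (PadicAlgCl ℓ), ρ.HasFrobCharpolyAt v P → ∀ β ∈ P.roots, IsAlgebraic ℚ β) → ∃ π : Literature.NumberTheory.Automorphic.CuspidalAutomorphicRepData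 n K hcpt, π.1.IsLAlgebraic ∧ ∀ᶠ v : IsDedekindDomain.HeightOneSpectrum (NumberField.RingOfIntegers K) in cofinite, SatakeFrobCompatibleAt ι π.1 ρ v

/-- complement cell (node-only, NOT a route item): **TRANSCENDENTAL WEAK AUTOMORPHY** — `B_w` on the ρ with a transcendental Frobenius root at
infinitely many places.  CERTIFIED S-VOID: `twa_of_fa : FrobeniusAlgebraicity → TranscendentalWeakAutomorphy` (the class is EMPTY under FA,
and FA is S-implied in kernel, `fa_of_langlands`). [conjecture] -/
def TranscendentalWeakAutomorphy : Prop :=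
  ∀ (K : Type) [Field K] [NumberField K] (n : ℕ) (hcpt : Literature.NumberTheory.Automorphic.isCompact_glFiniteIntegralLevel n K), 0 < n → ∀ (ℓ : ℕ) [Fact ℓ.Prime] (ι : PadicAlgCl ℓ ≃+* ℂ) (ρ : Literature.NumberTheory.GaloisRepresentations.FramedGaloisRep K (PadicAlgCl ℓ) n), ρ.toGaloisRep.IsIrreducible → ((∀ᶠ v : IsDedekindDomain.HeightOneSpectrum (NumberField.RingOfIntegers K) in cofinite, ρ.IsUnramifiedAt v) ∧ ∀ (v : IsDedekindDomain.HeightOneSpectrum (NumberField.RingOfIntegers K)) (hv : ((ℓ : ℕ) : NumberField.RingOfIntegers K) ∈ v.asIdeal), (Literature.NumberTheory.PAdicHodge.fontainePstAdicCompletion v ℓ hv).IsDeRhamFramed (ρ.toLocal v)) → ¬ (∀ᶠ v : IsDedekindDomain.HeightOneSpectrum (NumberField.RingOfIntegers K) in Filter.cofinite, ∀ P : Polynomial (PadicAlgCl ℓ), ρ.HasFrobCharpolyAt v P → ∀ β ∈ P.roots, IsAlgebraic ℚ β) → ∃ π : Literature.NumberTheory.Automorphic.CuspidalAutomorphicRepData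 n K hcpt, π.1.IsLAlgebraic ∧ ∀ᶠ v : IsDedekindDomain.HeightOneSpectrum (NumberField.RingOfIntegers K) in cofinite, SatakeFrobCompatibleAt ι π.1 ρ v

/-- node-local: the Assembly of this node (`closes_host`). -/
def ChildAssembly : Prop :=
  FrobeniusAlgebraicity → ArithmeticWeakAutomorphy → Summit.Langlands.Langlands.Theses.PrimeSwitchSplit.WeakGeometricAutomorphy

/-! ## Rung and S-case texts (BC5 / t3) -/

/-- rung of FA (PROVED, `finiteOrderAlgebraicityRung`): FA on FINITE-ORDER `ρ` (Artin representations read `ℓ`-adically) — every Frobenius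
root is a root of unity.  Its S-case `ArtinCase` (= `B_w` on finite-order ρ, the strong Artin conjecture) is NOT a theorem. -/
def FiniteOrderAlgebraicityRung : Prop :=
  ∀ (K : Type) [Field K] [NumberField K] (n : ℕ), 0 < n → ∀ (ℓ : ℕ) [Fact ℓ.Prime] (ρ : Literature.NumberTheory.GaloisRepresentations.FramedGaloisRep K (PadicAlgCl ℓ) n), ρ.toGaloisRep.IsIrreducible → (∃ k : ℕ, 0 < k ∧ ∀ σ : Field.absoluteGaloisGroup K, ρ σ ^ k = 1) → ((∀ᶠ v : IsDedekindDomain.HeightOneSpectrum (NumberField.RingOfIntegers K) in cofinite, ρ.IsUnramifiedAt v) ∧ ∀ (v : IsDedekindDomain.HeightOneSpectrum (NumberField.RingOfIntegers K)) (hv : ((ℓ : ℕ) : NumberField.RingOfIntegers K) ∈ v.asIdeal), (Literature.NumberTheory.PAdicHodge.fontainePstAdicCompletion v ℓ hv).IsDeRhamFramed (ρ.toLocal v)) → ∀ᶠ v : IsDedekindDomain.HeightOneSpectrum (NumberField.RingOfIntegers K) in Filter.cofinite, ∀ P : Polynomial (PadicAlgCl ℓ), ρ.HasFrobCharpolyAt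 v P → ∀ β ∈ P.roots, IsAlgebraic ℚ β

/-- rung of FA (PROVED, `projFiniteAlgebraicityRung`): FA on the `ρ` some power of which is an ALGEBRAIC scalar at every group element
(projectively finite with algebraic similitude: every twist of an Artin representation by a character with algebraic Frobenius values). -/
def ProjFiniteAlgebraicityRung : Prop :=
  ∀ (K : Type) [Field K] [NumberField K] (n : ℕ), 0 < n → ∀ (ℓ : ℕ) [Fact ℓ.Prime] (ρ : Literature.NumberTheory.GaloisRepresentations.FramedGaloisRep K (PadicAlgCl ℓ) n), ρ.toGaloisRep.IsIrreducible → (∃ k : ℕ, 0 < k ∧ ∀ σ : Field.absoluteGaloisGroup K, ∃ c : PadicAlgCl ℓ, IsAlgebraic ℚ c ∧ ((ρ σ : GL (Fin n) (PadicAlgCl ℓ)) : Matrix (Fin n) (Fin n) (PadicAlgCl ℓ)) ^ k = algebraMap (PadicAlgCl ℓ) (Matrix (Fin n) (Fin n) (PadicAlgCl ℓ)) c) → ((∀ᶠ v : IsDedekindDomain.HeightOneSpectrum (NumberField.RingOfIntegers K) in cofinite, ρ.IsUnramifiedAt v) ∧ ∀ (v : IsDedekindDomain.HeightOneSpectrum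 (NumberField.RingOfIntegers K)) (hv : ((ℓ : ℕ) : NumberField.RingOfIntegers K) ∈ v.asIdeal), (Literature.NumberTheory.PAdicHodge.fontainePstAdicCompletion v ℓ hv).IsDeRhamFramed (ρ.toLocal v)) → ∀ᶠ v : IsDedekindDomain.HeightOneSpectrum (NumberField.RingOfIntegers K) in Filter.cofinite, ∀ P : Polynomial (PadicAlgCl ℓ), ρ.HasFrobCharpolyAt v P → ∀ β ∈ P.roots, IsAlgebraic ℚ β

/-- rung of FA at `n = 1` (PROVED modulo the ONE named tree fact `FramedGaloisRep.exists_heckeCharacter_of_isDeRhamFramed`,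
`rankOneAlgebraicityRung_of_fact`): a de Rham `ℓ`-adic character has algebraic Frobenius values (Serre 1968 III + Weil 1956). [conjecture] -/
def RankOneAlgebraicityRung : Prop :=
  ∀ (K : Type) [Field K] [NumberField K] (ℓ : ℕ) [Fact ℓ.Prime] (ρ : Literature.NumberTheory.GaloisRepresentations.FramedGaloisRep K (PadicAlgCl ℓ) 1), ρ.toGaloisRep.IsIrreducible → ((∀ᶠ v : IsDedekindDomain.HeightOneSpectrum (NumberField.RingOfIntegers K) in cofinite, ρ.IsUnramifiedAt v) ∧ ∀ (v : IsDedekindDomain.HeightOneSpectrum (NumberField.RingOfIntegers K)) (hv : ((ℓ : ℕ) : NumberField.RingOfIntegers K) ∈ v.asIdeal), (Literature.NumberTheory.PAdicHodge.fontainePstAdicCompletion v ℓ hv).IsDeRhamFramed (ρ.toLocal v)) → ∀ᶠ v : IsDedekindDomain.HeightOneSpectrum (NumberField.RingOfIntegers K) in Filter.cofinite, ∀ P : Polynomial (PadicAlgCl ℓ), ρ.HasFrobCharpolyAt v P → ∀ β ∈ P.roots, IsAlgebraic ℚ β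

/-- S-case of the finite-order rung (t3): `B_w` on finite-order `ρ` = the strong Artin conjecture in the summit's typing; NOT a theorem
in the tree (OPEN for insoluble images; same text as the g31 node's `ArtinCase`). [conjecture] -/
def ArtinCase : Prop :=
  ∀ (K : Type) [Field K] [NumberField K] (n : ℕ) (hcpt : Literature.NumberTheory.Automorphic.isCompact_glFiniteIntegralLevel n K), 0 < n → ∀ (ℓ : ℕ) [Fact ℓ.Prime] (ι : PadicAlgCl ℓ ≃+* ℂ) (ρ : Literature.NumberTheory.GaloisRepresentations.FramedGaloisRep K (PadicAlgCl ℓ) n), ρ.toGaloisRep.IsIrreducible → (∃ k : ℕ, 0 < k ∧ ∀ σ : Field.absoluteGaloisGroup K, ρ σ ^ k = 1) → ((∀ᶠ v : IsDedekindDomain.HeightOneSpectrum (NumberField.RingOfIntegers K) in cofinite, ρ.IsUnramifiedAt v) ∧ ∀ (v : IsDedekindDomain.HeightOneSpectrum (NumberField.RingOfIntegers K)) (hv : ((ℓ : ℕ) : NumberField.RingOfIntegers K) ∈ v.asIdeal), (Literature.NumberTheory.PAdicHodge.fontainePstAdicCompletion v ℓ hv).IsDeRhamFramed (ρ.toLocal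 v)) → ∃ π : Literature.NumberTheory.Automorphic.CuspidalAutomorphicRepData n K hcpt, π.1.IsLAlgebraic ∧ ∀ᶠ v : IsDedekindDomain.HeightOneSpectrum (NumberField.RingOfIntegers K) in cofinite, SatakeFrobCompatibleAt ι π.1 ρ v

/-! ## The dial, named per representation -/

section Dial

open IsDedekindDomain NumberField Literature.NumberTheory.GaloisRepresentations Literature.NumberTheory.Automorphic

variable (K : Type) [Field K] [NumberField K] (ℓ : ℕ) [Fact ℓ.Prime]

/-- `ρ` HAS ALGEBRAIC FROBENIUS ROOTS at almost every place (the FA conclusion, literally; `ι`-free). [folklore] -/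
def HasAlgebraicFrobenius {n : ℕ} (ρ : FramedGaloisRep K (PadicAlgCl ℓ) n) : Prop :=
  ∀ᶠ v : IsDedekindDomain.HeightOneSpectrum (NumberField.RingOfIntegers K) in Filter.cofinite, ∀ P : Polynomial (PadicAlgCl ℓ), ρ.HasFrobCharpolyAt v P → ∀ β ∈ P.roots, IsAlgebraic ℚ β

variable {K ℓ}

/-! ### Kernel helpers -/

/-- a field isomorphism `ι : ℚ̄_ℓ ≃ ℂ` transports algebraicity over `ℚ` (it is a `ℚ`-algebra map). [folklore] -/
theorem isAlgebraic_symm (ι : PadicAlgCl ℓ ≃+* ℂ) {a : ℂ} (ha : IsAlgebraic ℚ a) : IsAlgebraic ℚ (ι.symm a) := by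
  simpa using ha.algHom ((ι.symm : ℂ ≃+* PadicAlgCl ℓ).toRingHom.toRatAlgHom)

/-- … and back. [folklore] -/
theorem isAlgebraic_of_symm (ι : PadicAlgCl ℓ ≃+* ℂ) {a : ℂ} (ha : IsAlgebraic ℚ (ι.symm a)) : IsAlgebraic ℚ a := by
  simpa using ha.algHom ((ι : PadicAlgCl ℓ ≃+* ℂ).toRingHom.toRatAlgHom)

/-- the inverse of an algebraic number is algebraic (via the algebraic closure of `ℚ` in the ambient field). [folklore] -/
theorem isAlgebraic_inv' {L : Type*} [Field L] [Algebra ℚ L] {x : L} (hx : IsAlgebraic ℚ x) : IsAlgebraic ℚ x⁻¹ :=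
  (mem_algebraicClosure_iff).mp (inv_mem ((mem_algebraicClosure_iff).mpr hx))

/-- a Frobenius characteristic polynomial at `v` IS the characteristic polynomial of `ρ(σ)` for a Frobenius `σ` at a prime above `v`
(a prime above `v` and a Frobenius at it exist). [folklore] -/
theorem exists_eq_charpoly_of_hasFrobCharpolyAt {n : ℕ} (ρ : FramedGaloisRep K (PadicAlgCl ℓ) n) {v : HeightOneSpectrum (𝓞 K)}
    {P : Polynomial (PadicAlgCl ℓ)} (hP : ρ.HasFrobCharpolyAt v P) :
    ∃ σ : Field.absoluteGaloisGroup K, (∃ 𝔓 ∈ v.primesAbove, IsArithFrobAt (𝓞 K) σ 𝔓) ∧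
      P = ((ρ σ : GL (Fin n) (PadicAlgCl ℓ)) : Matrix (Fin n) (Fin n) (PadicAlgCl ℓ)).charpoly := by
  obtain ⟨𝔓, h𝔓⟩ := v.primesAbove_nonempty
  obtain ⟨σ, hσ⟩ := HeightOneSpectrum.exists_isArithFrobAt_of_mem_primesAbove_holds h𝔓
  exact ⟨σ, ⟨𝔓, h𝔓, hσ⟩, (hP 𝔓 h𝔓 σ hσ).symm⟩

/-- **roots of the characteristic polynomial of a matrix `M` with `M ^ k = c` scalar are `k`-th roots of `c`**; if `c` is algebraic
so is every root. [folklore] -/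
theorem isAlgebraic_of_mem_roots_charpoly_of_pow_eq_scalar {n k : ℕ} (hk : 0 < k) {M : Matrix (Fin n) (Fin n) (PadicAlgCl ℓ)}
    {c : PadicAlgCl ℓ} (hc : IsAlgebraic ℚ c) (hM : M ^ k = algebraMap (PadicAlgCl ℓ) (Matrix (Fin n) (Fin n) (PadicAlgCl ℓ)) c)
    {β : PadicAlgCl ℓ} (hβ : β ∈ M.charpoly.roots) : IsAlgebraic ℚ β := by
  classical
  rcases Nat.eq_zero_or_pos n with hn0 | hnpos
  · exfalso
    subst hn0
    have h1 : M.charpoly = 1 := by unfold Matrix.charpoly; exact Matrix.det_isEmpty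
    rw [h1, Polynomial.roots_one] at hβ
    exact Multiset.notMem_zero _ hβ
  haveI : Nonempty (Fin n) := ⟨⟨0, hnpos⟩⟩
  have hroot : Polynomial.IsRoot M.charpoly β := Polynomial.isRoot_of_mem_roots hβ
  have hspec : β ∈ spectrum (PadicAlgCl ℓ) M := Matrix.mem_spectrum_of_isRoot_charpoly hroot
  have hspeck : β ^ k ∈ spectrum (PadicAlgCl ℓ) (M ^ k) := spectrum.pow_mem_pow M k hspec
  rw [hM, spectrum.scalar_eq, Set.mem_singleton_iff] at hspeck
  exact IsAlgebraic.of_pow hk (hspeck ▸ hc)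

/-- **FA for projectively-finite `ρ` with algebraic similitude, at EVERY place** (not only almost everywhere). [folklore] -/
theorem isAlgebraic_roots_of_projFiniteAlg {n : ℕ} (ρ : FramedGaloisRep K (PadicAlgCl ℓ) n) {k : ℕ} (hk : 0 < k)
    (hρ : ∀ σ : Field.absoluteGaloisGroup K, ∃ c : PadicAlgCl ℓ, IsAlgebraic ℚ c ∧
      ((ρ σ : GL (Fin n) (PadicAlgCl ℓ)) : Matrix (Fin n) (Fin n) (PadicAlgCl ℓ)) ^ k =
        algebraMap (PadicAlgCl ℓ) (Matrix (Fin n) (Fin n) (PadicAlgCl ℓ)) c)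
    (v : HeightOneSpectrum (𝓞 K)) (P : Polynomial (PadicAlgCl ℓ)) (hP : ρ.HasFrobCharpolyAt v P) :
    ∀ β ∈ P.roots, IsAlgebraic ℚ β := by
  intro β hβ
  obtain ⟨σ, -, hPσ⟩ := exists_eq_charpoly_of_hasFrobCharpolyAt ρ hP
  obtain ⟨c, hc, hM⟩ := hρ σ
  rw [hPσ] at hβ
  exact isAlgebraic_of_mem_roots_charpoly_of_pow_eq_scalar hk hc hM hβ

/-- hence for projectively-finite `ρ` with algebraic similitude: `HasAlgebraicFrobenius`. [folklore] -/
theorem hasAlgebraicFrobenius_of_projFiniteAlg {n : ℕ} (ρ : FramedGaloisRep K (PadicAlgCl ℓ) n) {k : ℕ} (hk : 0 < k)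
    (hρ : ∀ σ : Field.absoluteGaloisGroup K, ∃ c : PadicAlgCl ℓ, IsAlgebraic ℚ c ∧
      ((ρ σ : GL (Fin n) (PadicAlgCl ℓ)) : Matrix (Fin n) (Fin n) (PadicAlgCl ℓ)) ^ k =
        algebraMap (PadicAlgCl ℓ) (Matrix (Fin n) (Fin n) (PadicAlgCl ℓ)) c) :
    HasAlgebraicFrobenius K ℓ ρ :=
  Filter.Eventually.of_forall fun v P hP => isAlgebraic_roots_of_projFiniteAlg ρ hk hρ v P hP

/-- **FA for FINITE-ORDER `ρ`** (`c = 1`): every Frobenius root is a root of unity, at every place. [folklore] -/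
theorem hasAlgebraicFrobenius_of_finiteOrder {n : ℕ} (ρ : FramedGaloisRep K (PadicAlgCl ℓ) n) {k : ℕ} (hk : 0 < k)
    (hρ : ∀ σ : Field.absoluteGaloisGroup K, ρ σ ^ k = 1) : HasAlgebraicFrobenius K ℓ ρ :=
  hasAlgebraicFrobenius_of_projFiniteAlg ρ hk fun σ => ⟨1, isAlgebraic_one, by
    rw [← Units.val_pow_eq_pow_val, hρ σ, Units.val_one, map_one]⟩

/-- **FA at `n = 1` modulo ONE named tree fact** (`FramedGaloisRep.exists_heckeCharacter_of_isDeRhamFramed`: a de Rham `ℓ`-adic character is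
the avatar of an ALGEBRAIC Hecke character `χ`, Serre 1968 III §2.3 / Patrikis 2019 Prop. 2.2.1): the single Frobenius root at almost every
`v` is `ι⁻¹(χ(ϖ_v)⁻¹)`, and WEIL'S THEOREM — PROVED in the tree,
`HeckeCharacter.IsAlgebraic.exists_intermediateField_eventually_valueAtUniformizer_mem`: the values `χ(ϖ_v)` lie in ONE number field —
makes it algebraic. [folklore] -/
theorem hasAlgebraicFrobenius_rankOne_of_fact (hF : FramedGaloisRep.exists_heckeCharacter_of_isDeRhamFramed)
    (ρ : FramedGaloisRep K (PadicAlgCl ℓ) 1)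
    (hdR : ∀ (v : HeightOneSpectrum (𝓞 K)) (hv : ((ℓ : ℕ) : 𝓞 K) ∈ v.asIdeal),
      (Literature.NumberTheory.PAdicHodge.fontainePstAdicCompletion v ℓ hv).IsDeRhamFramed (ρ.toLocal v)) :
    HasAlgebraicFrobenius K ℓ ρ := by
  classical
  obtain ⟨ι⟩ := PadicAlgCl.nonempty_ringEquiv_complex ℓ
  obtain ⟨χ, hχalg, hχ⟩ := hF K ℓ ρ hdR ι
  obtain ⟨E, hfd, hE⟩ := hχalg.exists_intermediateField_eventually_valueAtUniformizer_mem
  haveI : FiniteDimensional ℚ E := hfd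
  filter_upwards [hχ, hE] with v hv hvE P hP β hβ
  obtain ⟨-, -, hFrob⟩ := hv
  obtain ⟨𝔓, h𝔓⟩ := v.primesAbove_nonempty
  obtain ⟨σ, hσ⟩ := HeightOneSpectrum.exists_isArithFrobAt_of_mem_primesAbove_holds h𝔓
  have hPeq : P = X - C (ι.symm (χ.valueAtUniformizer v)⁻¹) := (hP 𝔓 h𝔓 σ hσ).symm.trans (hFrob 𝔓 h𝔓 σ hσ)
  rw [hPeq, Polynomial.roots_X_sub_C, Multiset.mem_singleton] at hβ
  subst hβ
  have halg : IsAlgebraic ℚ (χ.valueAtUniformizer v) :=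
    IntermediateField.isAlgebraic_iff.mp (Algebra.IsAlgebraic.isAlgebraic (⟨χ.valueAtUniformizer v, hvE⟩ : E))
  exact isAlgebraic_symm ι (isAlgebraic_inv' halg)

end Dial

/-! ## Kernel: route texts ↔ the named dial; EXACTNESS of the carving; `closes_host` -/

section Kernel

open IsDedekindDomain NumberField Literature.NumberTheory.Automorphic Literature.NumberTheory.GaloisRepresentations

/-- FA IS the named dial under the Galois binders (definitional). [folklore] -/
theorem fa_iff_named : FrobeniusAlgebraicity ↔
    (∀ (K : Type) [Field K] [NumberField K] (n : ℕ), 0 < n → ∀ (ℓ : ℕ) [Fact ℓ.Prime]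
      (ρ : FramedGaloisRep K (PadicAlgCl ℓ) n), ρ.toGaloisRep.IsIrreducible →
      ((∀ᶠ v : IsDedekindDomain.HeightOneSpectrum (NumberField.RingOfIntegers K) in cofinite, ρ.IsUnramifiedAt v) ∧ ∀ (v : IsDedekindDomain.HeightOneSpectrum (NumberField.RingOfIntegers K)) (hv : ((ℓ : ℕ) : NumberField.RingOfIntegers K) ∈ v.asIdeal), (Literature.NumberTheory.PAdicHodge.fontainePstAdicCompletion v ℓ hv).IsDeRhamFramed (ρ.toLocal v)) →
      HasAlgebraicFrobenius K ℓ ρ) :=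
  ⟨fun h K _ _ n hn ℓ _ ρ hirr hgeo => h K n hn ℓ ρ hirr hgeo, fun h K _ _ n hn ℓ _ ρ hirr hgeo => h K n hn ℓ ρ hirr hgeo⟩

/-- **EXACTNESS (kernel, excluded middle on the dial)**: `B_w ↔ AWA ∧ TWA` — the carving loses nothing. [folklore] -/
theorem weakAut_iff_cells : Summit.Langlands.Langlands.Theses.PrimeSwitchSplit.WeakGeometricAutomorphy ↔
    (ArithmeticWeakAutomorphy ∧ TranscendentalWeakAutomorphy) := by
  constructor
  · intro h
    exact ⟨fun K _ _ n hcpt hn ℓ _ ι ρ hirr hgeo _ => h K n hcpt hn ℓ ι ρ hirr hgeo,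
      fun K _ _ n hcpt hn ℓ _ ι ρ hirr hgeo _ => h K n hcpt hn ℓ ι ρ hirr hgeo⟩
  · rintro ⟨hA, hT⟩ K _ _ n hcpt hn ℓ _ ι ρ hirr hgeo
    by_cases halg : HasAlgebraicFrobenius K ℓ ρ
    · exact hA K n hcpt hn ℓ ι ρ hirr hgeo halg
    · exact hT K n hcpt hn ℓ ι ρ hirr hgeo halg

/-- the residual is a restriction of the target: `B_w → AWA`. [folklore] -/
theorem awa_of_target (h : Summit.Langlands.Langlands.Theses.PrimeSwitchSplit.WeakGeometricAutomorphy) : ArithmeticWeakAutomorphy :=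
  (weakAut_iff_cells.1 h).1

/-- **THE CARVED CLASS IS VOID UNDER FA**: `FA → TWA` (the hypothesis `¬ HasAlgebraicFrobenius` of the complement cell is absurd). [folklore] -/
theorem twa_of_fa (hF : FrobeniusAlgebraicity) : TranscendentalWeakAutomorphy :=
  fun K _ _ n _ hn ℓ _ _ ρ hirr hgeo hnot => absurd (hF K n hn ℓ ρ hirr hgeo) hnot

/-- **closes_host** — the deciding implication of the node: `FA → AWA → B_w` (kernel, mod NOTHING). [folklore] -/
theorem closes_host (hF : FrobeniusAlgebraicity) (hA : ArithmeticWeakAutomorphy) :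
    Summit.Langlands.Langlands.Theses.PrimeSwitchSplit.WeakGeometricAutomorphy :=
  weakAut_iff_cells.2 ⟨hA, twa_of_fa hF⟩

/-- `ChildAssembly` holds (it is `closes_host`). [folklore] -/
theorem childAssembly_holds : ChildAssembly := closes_host

/-- **closes_root**: with the host route's other cruxes (W⁺ = `SatakeAvatarExistence` 17415, P = `PadicMemberCompatibility` 17534,
A = `CompatibilityAwayFromLR` 18084, R = `CanonicalReciprocityData` 17930; U = `AvatarConjugacy` PROVED, `AvatarConjugacy_holds`) the pieces
give `Langlands`, BY NAME through `PrimeSwitchSplit.closes`. [folklore] -/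
theorem closes_root (hF : FrobeniusAlgebraicity) (hA : ArithmeticWeakAutomorphy)
    (hWp : Summit.Langlands.Langlands.Theses.PrimeSwitchSplit.SatakeAvatarExistence)
    (hPm : Summit.Langlands.Langlands.Theses.PrimeSwitchSplit.PadicMemberCompatibility)
    (hAw : Summit.Langlands.Langlands.Theses.PrimeSwitchSplit.CompatibilityAwayFromLR)
    (hR : Summit.Langlands.Langlands.Theses.PrimeSwitchSplit.CanonicalReciprocityData) : _root_.Langlands :=
  Summit.Langlands.Langlands.Theses.PrimeSwitchSplit.closes (closes_host hF hA) hWp hPm hAw hR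
    Summit.Langlands.Langlands.Theses.PrimeSwitchSplit.AvatarConjugacy_holds

/-! ### Necessity: FA is S-implied IN KERNEL (mod nothing) -/

/-- the host crux `B_w` is S-implied (re-proved inline; = the private `target_of_langlands` of the g30 twin). [folklore] -/
private theorem weakAut_of_langlands (hL : _root_.Langlands) : Summit.Langlands.Langlands.Theses.PrimeSwitchSplit.WeakGeometricAutomorphy := by
  intro K _ _ n hcpt hn ℓ _ ι ρ hirr hgeo
  obtain ⟨⟨Rec⟩, h⟩ := hL K
  obtain ⟨π, hπ, hcorr⟩ := (h Rec n hn hcpt).2 ℓ ι ρ hirr ⟨hgeo.1, fun v hv => hgeo.2 v hv⟩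
  exact ⟨π, hπ, hcorr.1⟩

/-- **FA IS IMPLIED BY (B_w AND DIRECTION (A)), IN KERNEL.**  Given `B_w`, an irreducible geometric `ρ` is Satake–Frobenius compatible (through
ANY `ι`, one exists: `PadicAlgCl.nonempty_ringEquiv_complex`) with an L-algebraic cuspidal `π` at almost every `v`; given direction (A) for
`(K, n)`, the LANDED theorem `Theorems.lArithmeticOfAutToGal_proof` (item stmt-Langlands-1066, lens-6 g29: hidden arithmeticity of the `∀ ι`
statement, Steinitz) makes the Satake parameters `a` of `π` algebraic at almost every `v`; a Frobenius polynomial at such a `v` is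
`∏ (X - ι⁻¹(a⁻¹))` (`roots_arithFrobPolyOfSatake`, uniqueness through an actual Frobenius), so its roots `ι⁻¹(a⁻¹)` are algebraic. [folklore] -/
theorem fa_of_dirA_of_weakAut
    (hA : ∀ (K : Type) [Field K] [NumberField K] (n : ℕ) (hcpt : isCompact_glFiniteIntegralLevel n K), 0 < n →
      ∃ R : Summit.Langlands.ReciprocityData K, Summit.Langlands.AutomorphicToGalois n R hcpt)
    (hB : Summit.Langlands.Langlands.Theses.PrimeSwitchSplit.WeakGeometricAutomorphy) : FrobeniusAlgebraicity := by
  intro K _ _ n hn ℓ _ ρ hirr hgeo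
  classical
  have hcpt : isCompact_glFiniteIntegralLevel n K := isCompact_glFiniteIntegralLevel_holds n K
  obtain ⟨ι⟩ := PadicAlgCl.nonempty_ringEquiv_complex ℓ
  obtain ⟨π, hπalg, hcomp⟩ := hB K n hcpt hn ℓ ι ρ hirr hgeo
  obtain ⟨R, hAR⟩ := hA K n hcpt hn
  have h1066 := Summit.Langlands.Langlands.Theorems.lArithmeticOfAutToGal_proof K R n hcpt hAR π hπalg
  filter_upwards [hcomp, h1066] with v hv halg P hP β hβ
  obtain ⟨α, hα, -, hFrob⟩ := hv
  obtain ⟨𝔓, h𝔓⟩ := v.primesAbove_nonempty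
  obtain ⟨σ, hσ⟩ := HeightOneSpectrum.exists_isArithFrobAt_of_mem_primesAbove_holds h𝔓
  have hPeq : P = arithFrobPolyOfSatake ι v.residueCard 1 α := (hP 𝔓 h𝔓 σ hσ).symm.trans (hFrob 𝔓 h𝔓 σ hσ)
  rw [hPeq, roots_arithFrobPolyOfSatake, Multiset.mem_map] at hβ
  obtain ⟨a, ha, rfl⟩ := hβ
  have haalg : IsAlgebraic ℚ a := halg α hα a ha
  have h2 : IsAlgebraic ℚ ((((Real.sqrt (v.residueCard : ℕ) : ℝ) : ℂ) ^ (1 - 1) * a)⁻¹) := by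
    simpa using isAlgebraic_inv' haalg
  exact isAlgebraic_symm ι h2

/-- **FA IS S-IMPLIED (kernel, mod NOTHING)**: `Langlands → FA`. [folklore] -/
theorem fa_of_langlands (hL : _root_.Langlands) : FrobeniusAlgebraicity :=
  fa_of_dirA_of_weakAut (fun K _ _ n hcpt hn => by
    obtain ⟨⟨Rec⟩, h⟩ := hL K
    exact ⟨Rec, (h Rec n hn hcpt).1⟩) (weakAut_of_langlands hL)

/-- both pieces are S-implied: `Langlands → FA ∧ AWA`. [folklore] -/
theorem cells_of_langlands (hL : _root_.Langlands) : FrobeniusAlgebraicity ∧ ArithmeticWeakAutomorphy :=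
  ⟨fa_of_langlands hL, awa_of_target (weakAut_of_langlands hL)⟩

/-- EXACTNESS at the level of the target, modulo direction (A): `(A) → (B_w ↔ FA ∧ AWA)`. [folklore] -/
theorem cells_iff_target_modA
    (hA : ∀ (K : Type) [Field K] [NumberField K] (n : ℕ) (hcpt : isCompact_glFiniteIntegralLevel n K), 0 < n →
      ∃ R : Summit.Langlands.ReciprocityData K, Summit.Langlands.AutomorphicToGalois n R hcpt) :
    Summit.Langlands.Langlands.Theses.PrimeSwitchSplit.WeakGeometricAutomorphy ↔ (FrobeniusAlgebraicity ∧ ArithmeticWeakAutomorphy) :=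
  ⟨fun h => ⟨fa_of_dirA_of_weakAut hA h, awa_of_target h⟩, fun h => closes_host h.1 h.2⟩

end Kernel

/-! ## Rungs (BC5) and S-cases (t3) -/

section Rungs

open IsDedekindDomain NumberField Literature.NumberTheory.GaloisRepresentations

/-- the finite-order rung is a restriction of FA. [folklore] -/
theorem finiteOrderAlgebraicityRung_of_fa (h : FrobeniusAlgebraicity) : FiniteOrderAlgebraicityRung :=
  fun K _ _ n hn ℓ _ ρ hirr _ hgeo => h K n hn ℓ ρ hirr hgeo

/-- **the finite-order rung HOLDS** (kernel; the regime contains every Artin representation, where `B_w` = strong Artin is OPEN). [folklore] -/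
theorem finiteOrderAlgebraicityRung : FiniteOrderAlgebraicityRung :=
  fun K _ _ n hn ℓ _ ρ _ hfin _ => by
    obtain ⟨k, hk, hρ⟩ := hfin
    exact hasAlgebraicFrobenius_of_finiteOrder ρ hk hρ

/-- the projectively-finite rung is a restriction of FA. [folklore] -/
theorem projFiniteAlgebraicityRung_of_fa (h : FrobeniusAlgebraicity) : ProjFiniteAlgebraicityRung :=
  fun K _ _ n hn ℓ _ ρ hirr _ hgeo => h K n hn ℓ ρ hirr hgeo

/-- **the projectively-finite rung HOLDS** (kernel). [folklore] -/
theorem projFiniteAlgebraicityRung : ProjFiniteAlgebraicityRung :=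
  fun K _ _ n hn ℓ _ ρ _ hpf _ => by
    obtain ⟨k, hk, hρ⟩ := hpf
    exact hasAlgebraicFrobenius_of_projFiniteAlg ρ hk hρ

/-- the rank-one rung is a restriction of FA. [folklore] -/
theorem rankOneAlgebraicityRung_of_fa (h : FrobeniusAlgebraicity) : RankOneAlgebraicityRung :=
  fun K _ _ ℓ _ ρ hirr hgeo => h K 1 Nat.one_pos ℓ ρ hirr hgeo

/-- **the rank-one rung HOLDS modulo the named fact** `FramedGaloisRep.exists_heckeCharacter_of_isDeRhamFramed` (cited BY NAME). [folklore] -/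
theorem rankOneAlgebraicityRung_of_fact (hF : FramedGaloisRep.exists_heckeCharacter_of_isDeRhamFramed) : RankOneAlgebraicityRung :=
  fun _ _ _ _ _ ρ _ hgeo => hasAlgebraicFrobenius_rankOne_of_fact hF ρ hgeo.2

/-- the S-case of the finite-order rung is a restriction of `B_w`. [folklore] -/
theorem artinCase_of_weakAut (h : Summit.Langlands.Langlands.Theses.PrimeSwitchSplit.WeakGeometricAutomorphy) : ArtinCase :=
  fun K _ _ n hcpt hn ℓ _ ι ρ hirr _ hgeo => h K n hcpt hn ℓ ι ρ hirr hgeo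

/-- … and of the residual AWA (finite order ⇒ algebraic Frobenius): the Artin sector lies INSIDE the residual. [folklore] -/
theorem artinCase_of_awa (h : ArithmeticWeakAutomorphy) : ArtinCase :=
  fun K _ _ n hcpt hn ℓ _ ι ρ hirr hfin hgeo => by
    obtain ⟨k, hk, hρ⟩ := hfin
    exact h K n hcpt hn ℓ ι ρ hirr hgeo (hasAlgebraicFrobenius_of_finiteOrder ρ hk hρ)

end Rungs

end Summit.Langlands.Langlands.Theorems.FrobeniusAlgebraicityCarving
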